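import Summits.AnomalousDissipation.AnomalousDissipation.Theorems.SoloInformedDriftStates
import Literature.Analysis.PDE.ParabolicSchauderBlowUp

/-!
# Drift states II: the dissipation-rate ceiling of the laminar drift class (solo-informed)

For the `2½`-dimensional constant-drift states `U_ν = (c, R_ν) ∘ π` of `SoloInformedDriftStates`
(drift `c ∈ ℝ²`, injectively placed frequencies `k_n ≠ 0`, rapidly decaying force amplitudes
`w_n`, non-resonance `σ_n = 2π c·k_n ≠ 0`) with finite inviscid energy `∑_n |w_n|²/σ_n² < ∞`:

**Theorem** (`dissipation_UD_le_rpow`). For every `θ ∈ [0,1)` there is `C_θ` with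
`ν ‖∇U_ν‖₂² ≤ C_θ ν^θ` for all `ν > 0` — the enstrophy of a laminar drift state may blow up as
`ν → 0` (it does for the Liouville states of `SoloInformedLiouvilleStates`), but never faster
than `ν^{-1+θ}`.  In the vocabulary of the zeroth law (`driftClass_meanDissipation_le_rpow`,
`driftClass_no_dissipationFloor`): every fixed-force Leray–Hopf family drawn from the class
(`u_j = U_{ν_j}`, `ν_j → 0`) has bounded mean energy and `meanDissipation(ν_j,u_j) ≤ C_θ ν_j^θ`,
hence no dissipation floor `ε > 0`, whatever the drift direction and the smooth force profile.
(If `∑_n √λ_n |w_n|/|σ_n| < ∞`, a Diophantine condition on `c`, the enstrophy stays bounded.)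

**Proof.** `ν‖∇U_ν‖₂² ≤ 2(∑_n X_n)²`, `X_n² = νλ_n|z_n(ν)|² = x r²/(a²+x²)` with `a = |σ_n|`,
`x = νλ_n`, `r = |w_n|`; per mode `x r²/(a²+x²) ≤ x^θ r^{1-θ}(1 + r²/a²)` (from
`x^{1-θ}a^{1+θ} ≤ a²+x²`), `x^θ ≤ ν^θ W_n²` (`W_n = 2π(1+|k_n|²)`) and
`r^{1-θ} W_n^6 ≤ 1 + ∑_i |w_i| W_i^m` once `m(1-θ) ≥ 6` (rapid decay); so
`X_n ≤ √(ν^θ(1+D_m)) (1 + r²/a²) W_n^{-2}`, summable since `∑_{K∈ℤ²} ‖K‖^{-4} < ∞`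
(Mathlib `EisensteinSeries.summable_one_div_norm_rpow`).

References: A. Cheskidov, arXiv:2311.04182 §6 [Cheskidov2023]; L. Grafakos, *Classical Fourier
Analysis* (2014) Prop. 3.2.6 [Grafakos2014].
-/

noncomputable section

open MeasureTheory Filter Topology Set UnitAddTorus
open scoped ENNReal NNReal Real

namespace Summit.AnomalousDissipation.AnomalousDissipation.Theorems

open Literature.Analysis.FunctionSpaces Literature.Analysis.FunctionSpaces.Torus
  Literature.Analysis.FluidPDE

variable {c : EuclideanSpace ℝ (Fin 2)} {k : ℕ → Fin 2 → ℤ} {w : ℕ → ℂ}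

/-! ## Termwise gradient amplitudes -/

/-- `2π |k_{n,j}| ≤ √λ_n`. [folklore] -/
theorem two_pi_mul_abs_apply_le_sqrt_lamD (n : ℕ) (j : Fin 2) :
    2 * Real.pi * |(k n j : ℝ)| ≤ Real.sqrt (lamD k n) := by
  have h : ((k n j : ℤ) : ℝ) ^ 2 ≤ freqNormSq (k n) := by
    unfold freqNormSq
    exact Finset.single_le_sum (f := fun i => ((k n i : ℤ) : ℝ) ^ 2) (fun i _ => sq_nonneg _)
      (Finset.mem_univ j)
  refine Real.le_sqrt_of_sq_le ?_
  calc (2 * Real.pi * |(k n j : ℝ)|) ^ 2 = 4 * Real.pi ^ 2 * ((k n j : ℤ) : ℝ) ^ 2 := by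
        rw [mul_pow, mul_pow, sq_abs]; ring
    _ ≤ lamD k n := by unfold lamD; nlinarith [mul_pos Real.pi_pos Real.pi_pos]

/-- `|2πi k_{n,j} z_n(ν)| ≤ √λ_n |z_n(ν)|`. [folklore] -/
theorem norm_derivCoeff_le (ν : ℝ) (n : ℕ) (j : Fin 2) :
    ‖2 * Real.pi * Complex.I * ((k n j : ℤ) : ℂ) * zD c k w ν n‖ ≤
      Real.sqrt (lamD k n) * ‖zD c k w ν n‖ := by
  have h1 : ‖2 * Real.pi * Complex.I * ((k n j : ℤ) : ℂ) * zD c k w ν n‖ =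
      2 * Real.pi * |(k n j : ℝ)| * ‖zD c k w ν n‖ := by
    simp only [norm_mul, Complex.norm_real, Real.norm_eq_abs, Complex.norm_I, mul_one,
      Complex.norm_intCast, abs_of_pos Real.pi_pos]
    norm_num
  rw [h1]
  exact mul_le_mul_of_nonneg_right (two_pi_mul_abs_apply_le_sqrt_lamD n j) (norm_nonneg _)

/-- `√λ_n ≤ W_n = 2π(1+|k_n|²)`. [folklore] -/
theorem sqrt_lamD_le (n : ℕ) : Real.sqrt (lamD k n) ≤ 2 * Real.pi * (1 + freqNormSq (k n)) := by
  calc Real.sqrt (lamD k n) ≤ Real.sqrt ((2 * Real.pi * (1 + freqNormSq (k n))) ^ 2) :=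
        Real.sqrt_le_sqrt (lamD_le_weight_sq n)
    _ = 2 * Real.pi * (1 + freqNormSq (k n)) :=
        Real.sqrt_sq (by have := freqNormSq_nonneg (k n); positivity)

/-- `1 ≤ W_n`. [folklore] -/
theorem one_le_weightD (n : ℕ) : 1 ≤ 2 * Real.pi * (1 + freqNormSq (k n)) := by
  have := freqNormSq_nonneg (k n); nlinarith [Real.pi_gt_three]

/-- `∑_n √λ_n |z_n(ν)| < ∞` for `ν > 0`. [folklore] -/
theorem summable_gradAmpD {ν : ℝ} (hν : 0 < ν) (hk : ∀ n, k n ≠ 0) (hw : RapidDecay k w) :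
    Summable fun n => Real.sqrt (lamD k n) * ‖zD c k w ν n‖ := by
  refine Summable.of_nonneg_of_le (fun n => mul_nonneg (Real.sqrt_nonneg _) (norm_nonneg _))
    (fun n => ?_) (rapidDecay_zD (c := c) hν hk hw 1)
  rw [pow_one, mul_comm]
  exact mul_le_mul_of_nonneg_left (sqrt_lamD_le n) (norm_nonneg _)

/-- **Pointwise gradient bound** `|∂ⱼR_ν(y)| ≤ ∑_n √λ_n |z_n(ν)|`.
[cite: Grafakos2014, Prop. 3.2.6 (8)] -/
theorem abs_partialDeriv_RD_le {ν : ℝ} (hν : 0 < ν) (hk : ∀ n, k n ≠ 0) (hw : RapidDecay k w)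
    (j : Fin 2) (y : UnitAddTorus (Fin 2)) :
    |partialDeriv j (RD c k w ν) y| ≤ ∑' n, (Real.sqrt (lamD k n) * ‖zD c k w ν n‖) := by
  have h := (rapidDecay_zD (c := c) hν hk hw).partialDeriv_modeSeries j y
  rw [RD, h, ← Real.norm_eq_abs]
  exact tsum_of_norm_bounded (summable_gradAmpD hν hk hw).hasSum
    fun n => (norm_rmode_le _ _ _).trans (norm_derivCoeff_le ν n j)

/-- `‖∇R_ν‖²_{L²} ≤ 2 (∑_n √λ_n |z_n(ν)|)²`. [folklore] -/
theorem scalarGradNormSq_RD_le {ν : ℝ} (hν : 0 < ν) (hk : ∀ n, k n ≠ 0) (hw : RapidDecay k w) :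
    Torus.scalarGradNormSq (RD c k w ν) ≤
      2 * (∑' n, (Real.sqrt (lamD k n) * ‖zD c k w ν n‖)) ^ 2 := by
  have hR := isSmooth_RD (c := c) hν hk hw
  rw [Torus.scalarGradNormSq_eq_sum_integral hR]
  have h1 : ∀ j : Fin 2, ∫ y, partialDeriv j (RD c k w ν) y ^ 2 ≤
      (∑' n, (Real.sqrt (lamD k n) * ‖zD c k w ν n‖)) ^ 2 := fun j =>
    calc ∫ y, partialDeriv j (RD c k w ν) y ^ 2
        ≤ ∫ _ : UnitAddTorus (Fin 2), (∑' n, (Real.sqrt (lamD k n) * ‖zD c k w ν n‖)) ^ 2 := by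
          refine integral_mono ((hR.partialDeriv j).continuous.pow 2).integrable_unitAddTorus
            (integrable_const _) fun y => ?_
          calc partialDeriv j (RD c k w ν) y ^ 2 = |partialDeriv j (RD c k w ν) y| ^ 2 :=
              (sq_abs _).symm
            _ ≤ _ := pow_le_pow_left₀ (abs_nonneg _) (abs_partialDeriv_RD_le hν hk hw j y) 2
      _ = (∑' n, (Real.sqrt (lamD k n) * ‖zD c k w ν n‖)) ^ 2 := by simp
  calc ∑ j : Fin 2, ∫ y, partialDeriv j (RD c k w ν) y ^ 2
      ≤ ∑ _j : Fin 2, (∑' n, (Real.sqrt (lamD k n) * ‖zD c k w ν n‖)) ^ 2 :=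
        Finset.sum_le_sum fun j _ => h1 j
    _ = 2 * (∑' n, (Real.sqrt (lamD k n) * ‖zD c k w ν n‖)) ^ 2 := by simp [two_mul]

/-- `ν ‖∇U_ν‖₂² ≤ 2 (∑_n X_n)²`, `X_n = √ν √λ_n |z_n(ν)|`. [folklore] -/
theorem dissipation_UD_le {ν : ℝ} (hν : 0 < ν) (hk : ∀ n, k n ≠ 0) (hw : RapidDecay k w) :
    ν * (eGradNormSq (UD c k w ν)).toReal ≤
      2 * (∑' n, Real.sqrt ν * (Real.sqrt (lamD k n) * ‖zD c k w ν n‖)) ^ 2 := by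
  rw [toReal_eGradNormSq_UD hν hk hw, tsum_mul_left, mul_pow, Real.sq_sqrt hν.le]
  nlinarith [scalarGradNormSq_RD_le (c := c) hν hk hw,
    sq_nonneg (∑' n, (Real.sqrt (lamD k n) * ‖zD c k w ν n‖))]

/-! ## Elementary inequalities -/

/-- `u^p ≤ 1 + u²` for `u ≥ 0`, `0 ≤ p ≤ 2`. [folklore] -/
theorem rpow_le_one_add_sq {u p : ℝ} (hu : 0 ≤ u) (hp0 : 0 ≤ p) (hp2 : p ≤ 2) :
    u ^ p ≤ 1 + u ^ 2 := by
  rcases le_total u 1 with h | h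
  · exact (Real.rpow_le_one hu h hp0).trans (by nlinarith)
  · calc u ^ p ≤ u ^ (2 : ℝ) := Real.rpow_le_rpow_of_exponent_le h hp2
      _ ≤ 1 + u ^ 2 := by rw [Real.rpow_two]; linarith

/-- `x^{1-θ} a^{1+θ} ≤ a² + x²` for `a, x > 0`, `θ ∈ [0,1]`. [folklore] -/
theorem rpow_mul_rpow_le_sq_add_sq {a x θ : ℝ} (ha : 0 < a) (hx : 0 < x) (hθ0 : 0 ≤ θ)
    (hθ1 : θ ≤ 1) : x ^ (1 - θ) * a ^ (1 + θ) ≤ a ^ 2 + x ^ 2 := by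
  have h2 : (1 - θ) + (1 + θ) = 2 := by ring
  rcases le_total x a with hxa | hax
  · have h : x ^ (1 - θ) ≤ a ^ (1 - θ) := Real.rpow_le_rpow hx.le hxa (by linarith)
    calc x ^ (1 - θ) * a ^ (1 + θ) ≤ a ^ (1 - θ) * a ^ (1 + θ) :=
          mul_le_mul_of_nonneg_right h (Real.rpow_nonneg ha.le _)
      _ = a ^ 2 := by rw [← Real.rpow_add ha, h2, Real.rpow_two]
      _ ≤ a ^ 2 + x ^ 2 := by nlinarith
  · have h : a ^ (1 + θ) ≤ x ^ (1 + θ) := Real.rpow_le_rpow ha.le hax (by linarith)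
    calc x ^ (1 - θ) * a ^ (1 + θ) ≤ x ^ (1 - θ) * x ^ (1 + θ) :=
          mul_le_mul_of_nonneg_left h (Real.rpow_nonneg hx.le _)
      _ = x ^ 2 := by rw [← Real.rpow_add hx, h2, Real.rpow_two]
      _ ≤ a ^ 2 + x ^ 2 := by nlinarith

/-- **The per-mode interpolation**: `x r²/(a²+x²) ≤ x^θ r^{1-θ} (1 + r²/a²)` for `a, x > 0`,
`r ≥ 0`, `θ ∈ [0,1)`. [folklore] -/
theorem perMode_le {a x r θ : ℝ} (ha : 0 < a) (hx : 0 < x) (hr : 0 ≤ r) (hθ0 : 0 ≤ θ)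
    (hθ1 : θ < 1) : x * r ^ 2 / (a ^ 2 + x ^ 2) ≤ x ^ θ * r ^ (1 - θ) * (1 + r ^ 2 / a ^ 2) := by
  rcases hr.eq_or_lt with h0 | hr0
  · have : x * r ^ 2 / (a ^ 2 + x ^ 2) = 0 := by rw [← h0]; simp
    rw [this]; positivity
  have hxsplit : x ^ θ * x ^ (1 - θ) = x := by
    rw [← Real.rpow_add hx, show θ + (1 - θ) = 1 by ring, Real.rpow_one]
  have hkey : x * a ^ (1 + θ) ≤ x ^ θ * (a ^ 2 + x ^ 2) := by
    calc x * a ^ (1 + θ) = x ^ θ * (x ^ (1 - θ) * a ^ (1 + θ)) := by rw [← mul_assoc, hxsplit]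
      _ ≤ x ^ θ * (a ^ 2 + x ^ 2) := mul_le_mul_of_nonneg_left
          (rpow_mul_rpow_le_sq_add_sq ha hx hθ0 hθ1.le) (Real.rpow_nonneg hx.le _)
  have hrA : (r / a) ^ (1 + θ) ≤ 1 + r ^ 2 / a ^ 2 := by
    have := rpow_le_one_add_sq (div_nonneg hr ha.le) (by linarith) (by linarith : 1 + θ ≤ 2)
    rwa [div_pow] at this
  have hr2 : r ^ (1 - θ) * (r / a) ^ (1 + θ) = r ^ 2 / a ^ (1 + θ) := by
    have h2 : (1 - θ) + (1 + θ) = 2 := by ring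
    rw [Real.div_rpow hr ha.le, ← mul_div_assoc, ← Real.rpow_add hr0, h2, Real.rpow_two]
  have hA : 0 < a ^ (1 + θ) := Real.rpow_pos_of_pos ha _
  calc x * r ^ 2 / (a ^ 2 + x ^ 2) ≤ x ^ θ * (r ^ 2 / a ^ (1 + θ)) := by
        rw [div_le_iff₀ (by positivity : 0 < a ^ 2 + x ^ 2),
          show x ^ θ * (r ^ 2 / a ^ (1 + θ)) * (a ^ 2 + x ^ 2) =
            x ^ θ * (a ^ 2 + x ^ 2) * r ^ 2 / a ^ (1 + θ) by ring, le_div_iff₀ hA]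
        nlinarith [mul_le_mul_of_nonneg_right hkey (sq_nonneg r)]
    _ = x ^ θ * (r ^ (1 - θ) * (r / a) ^ (1 + θ)) := by rw [hr2]
    _ ≤ x ^ θ * (r ^ (1 - θ) * (1 + r ^ 2 / a ^ 2)) := mul_le_mul_of_nonneg_left
        (mul_le_mul_of_nonneg_left hrA (Real.rpow_nonneg hr _)) (Real.rpow_nonneg hx.le _)
    _ = x ^ θ * r ^ (1 - θ) * (1 + r ^ 2 / a ^ 2) := by ring

/-- **The lattice sum** `∑_n W_n^{-2} < ∞` over injectively placed frequencies
(`∑_{K ∈ ℤ²} ‖K‖^{-4} < ∞`). [folklore] -/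
theorem summable_inv_weightD_sq (hk : Function.Injective k) :
    Summable fun n => ((2 * Real.pi * (1 + freqNormSq (k n))) ^ 2)⁻¹ := by
  have hg : Summable fun K : Fin 2 → ℤ => ((2 * Real.pi * (1 + freqNormSq K)) ^ 2)⁻¹ := by
    refine Summable.of_norm_bounded_eventually (g := fun K : Fin 2 → ℤ => ‖K‖ ^ (-4 : ℝ))
      (EisensteinSeries.summable_one_div_norm_rpow (by norm_num)) ?_
    filter_upwards [eventually_cofinite_ne (0 : Fin 2 → ℤ)] with K hK
    have hF := freqNormSq_nonneg K
    rw [Real.norm_eq_abs, abs_of_nonneg (by positivity), Real.rpow_neg (norm_nonneg _),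
      show (4 : ℝ) = ((4 : ℕ) : ℝ) by norm_num, Real.rpow_natCast]
    have hKpos : 0 < ‖K‖ := norm_pos_iff.2 hK
    refine inv_anti₀ (by positivity) ?_
    have h1 : ‖K‖ ^ 2 ≤ freqNormSq K := by
      have h : ‖K‖ ≤ Real.sqrt (freqNormSq K) := by
        refine (pi_norm_le_iff_of_nonneg (Real.sqrt_nonneg _)).2 fun i => ?_
        rw [Int.norm_eq_abs]
        refine Real.abs_le_sqrt ?_
        unfold freqNormSq
        exact Finset.single_le_sum (f := fun j => ((K j : ℤ) : ℝ) ^ 2) (fun j _ => sq_nonneg _)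
          (Finset.mem_univ i)
      calc ‖K‖ ^ 2 ≤ Real.sqrt (freqNormSq K) ^ 2 := pow_le_pow_left₀ (norm_nonneg _) h 2
        _ = freqNormSq K := Real.sq_sqrt hF
    calc ‖K‖ ^ 4 = (‖K‖ ^ 2) ^ 2 := by ring
      _ ≤ freqNormSq K ^ 2 := pow_le_pow_left₀ (by positivity) h1 2
      _ ≤ (2 * Real.pi * (1 + freqNormSq K)) ^ 2 := by
          refine pow_le_pow_left₀ hF ?_ 2; nlinarith [Real.pi_gt_three]
  exact hg.comp_injective hk

/-- A summable non-negative sequence is square summable. [folklore] -/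
theorem summable_sq_of_summable {a : ℕ → ℝ} (h0 : ∀ n, 0 ≤ a n) (ha : Summable a) :
    Summable fun n => a n ^ 2 := by
  refine Summable.of_nonneg_of_le (fun n => sq_nonneg _) (fun n => ?_) (ha.mul_left (∑' i, a i))
  rw [sq]
  exact mul_le_mul_of_nonneg_right (ha.le_tsum n fun j _ => h0 j) (h0 n)

/-! ## The rate ceiling -/

/-- Per mode: `νλ_n |z_n(ν)|² ≤ (νλ_n)^θ |w_n|^{1-θ} (1 + |w_n|²/σ_n²)`. [folklore] -/
theorem sq_gradAmpD_le {ν : ℝ} (hν : 0 < ν) {n : ℕ} (hk : k n ≠ 0) (hσ : σD c k n ≠ 0)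
    {θ : ℝ} (hθ0 : 0 ≤ θ) (hθ1 : θ < 1) :
    ν * lamD k n * ‖zD c k w ν n‖ ^ 2 ≤
      (ν * lamD k n) ^ θ * ‖w n‖ ^ (1 - θ) * (1 + ‖w n‖ ^ 2 / σD c k n ^ 2) := by
  have hx : 0 < ν * lamD k n := mul_pos hν (lt_of_lt_of_le one_pos (one_le_lamD hk))
  rw [norm_sq_zD, ← sq_abs (σD c k n), ← mul_div_assoc]
  exact perMode_le (abs_pos.2 hσ) hx (norm_nonneg _) hθ0 hθ1

/-- `(νλ_n)^θ ≤ ν^θ W_n²`. [folklore] -/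
theorem rpow_mul_lamD_le {ν : ℝ} (hν : 0 < ν) {n : ℕ} (hk : k n ≠ 0) {θ : ℝ} (hθ1 : θ ≤ 1) :
    (ν * lamD k n) ^ θ ≤ ν ^ θ * (2 * Real.pi * (1 + freqNormSq (k n))) ^ 2 := by
  rw [Real.mul_rpow hν.le (lamD_nonneg n)]
  refine mul_le_mul_of_nonneg_left ?_ (Real.rpow_nonneg hν.le θ)
  calc lamD k n ^ θ ≤ lamD k n ^ (1 : ℝ) := Real.rpow_le_rpow_of_exponent_le (one_le_lamD hk) hθ1
    _ ≤ _ := by rw [Real.rpow_one]; exact lamD_le_weight_sq n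

/-- Rapid decay: `|w_n|^{1-θ} W_n^6 ≤ 1 + D_m`, `D_m = ∑_i |w_i| W_i^m`, once `m(1-θ) ≥ 6`.
[folklore] -/
theorem rpow_norm_mul_weightD_le (hw : RapidDecay k w) {θ : ℝ} (hθ0 : 0 ≤ θ) (hθ1 : θ < 1)
    {m : ℕ} (hm : 6 ≤ (m : ℝ) * (1 - θ)) (n : ℕ) :
    ‖w n‖ ^ (1 - θ) * (2 * Real.pi * (1 + freqNormSq (k n))) ^ 6 ≤
      1 + ∑' i, ‖w i‖ * (2 * Real.pi * (1 + freqNormSq (k i))) ^ m := by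
  have hW1 := one_le_weightD (k := k) n
  have hW0 : 0 ≤ 2 * Real.pi * (1 + freqNormSq (k n)) := by linarith
  have hD : ‖w n‖ * (2 * Real.pi * (1 + freqNormSq (k n))) ^ m ≤
      ∑' i, ‖w i‖ * (2 * Real.pi * (1 + freqNormSq (k i))) ^ m :=
    (hw m).le_tsum n (fun i _ => mul_nonneg (norm_nonneg _) (weightD_pow_nonneg i m))
  have hD0 : 0 ≤ ∑' i, ‖w i‖ * (2 * Real.pi * (1 + freqNormSq (k i))) ^ m :=
    tsum_nonneg fun i => mul_nonneg (norm_nonneg _) (weightD_pow_nonneg i m)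
  calc ‖w n‖ ^ (1 - θ) * (2 * Real.pi * (1 + freqNormSq (k n))) ^ 6
      ≤ ‖w n‖ ^ (1 - θ) * (2 * Real.pi * (1 + freqNormSq (k n))) ^ ((m : ℝ) * (1 - θ)) := by
        refine mul_le_mul_of_nonneg_left ?_ (Real.rpow_nonneg (norm_nonneg _) _)
        rw [show (2 * Real.pi * (1 + freqNormSq (k n))) ^ 6 =
          (2 * Real.pi * (1 + freqNormSq (k n))) ^ ((6 : ℕ) : ℝ) from (Real.rpow_natCast _ 6).symm]
        exact Real.rpow_le_rpow_of_exponent_le hW1 (by simpa using hm)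
    _ = (‖w n‖ * (2 * Real.pi * (1 + freqNormSq (k n))) ^ m) ^ (1 - θ) := by
        rw [Real.mul_rpow (norm_nonneg _) (pow_nonneg hW0 m), ← Real.rpow_natCast _ m,
          ← Real.rpow_mul hW0]
    _ ≤ (∑' i, ‖w i‖ * (2 * Real.pi * (1 + freqNormSq (k i))) ^ m) ^ (1 - θ) :=
        Real.rpow_le_rpow (mul_nonneg (norm_nonneg _) (pow_nonneg hW0 m)) hD (by linarith)
    _ ≤ _ := Literature.Analysis.PDE.rpow_le_one_add hD0 (by linarith) (by linarith)

/-- **The rate ceiling.**  In the laminar drift class with finite inviscid energy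
`∑_n |w_n|²/σ_n² < ∞`: for every `θ ∈ [0,1)` there is `C` with `ν ‖∇U_ν‖₂² ≤ C ν^θ` for all
`ν > 0`. [folklore] -/
theorem dissipation_UD_le_rpow (hkinj : Function.Injective k) (hk : ∀ n, k n ≠ 0)
    (hw : RapidDecay k w) (hσ : ∀ n, σD c k n ≠ 0)
    (he : Summable fun n => ‖w n‖ ^ 2 / σD c k n ^ 2) {θ : ℝ} (hθ0 : 0 ≤ θ) (hθ1 : θ < 1) :
    ∃ C : ℝ, ∀ ν : ℝ, 0 < ν → ν * (eGradNormSq (UD c k w ν)).toReal ≤ C * ν ^ θ := by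
  obtain ⟨m, hm⟩ := exists_nat_ge (6 / (1 - θ))
  have hm' : 6 ≤ (m : ℝ) * (1 - θ) := (div_le_iff₀ (by linarith : 0 < 1 - θ)).1 hm
  obtain ⟨D, hD⟩ : ∃ D : ℝ, (∑' i, ‖w i‖ * (2 * Real.pi * (1 + freqNormSq (k i))) ^ m) = D :=
    ⟨_, rfl⟩
  have hD0 : 0 ≤ D := hD ▸ tsum_nonneg fun i => mul_nonneg (norm_nonneg _) (weightD_pow_nonneg i m)
  -- the summable majorant `(1 + e_n) W_n^{-2}`
  have he0 : ∀ n, 0 ≤ ‖w n‖ ^ 2 / σD c k n ^ 2 := fun n => by positivity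
  have hS : Summable fun n =>
      (1 + ‖w n‖ ^ 2 / σD c k n ^ 2) * ((2 * Real.pi * (1 + freqNormSq (k n))) ^ 2)⁻¹ := by
    refine Summable.of_nonneg_of_le (fun n => by have := he0 n; positivity) (fun n => ?_)
      ((summable_inv_weightD_sq hkinj).add he)
    have hW1 := one_le_weightD (k := k) n
    have h2 : ‖w n‖ ^ 2 / σD c k n ^ 2 * ((2 * Real.pi * (1 + freqNormSq (k n))) ^ 2)⁻¹ ≤
        ‖w n‖ ^ 2 / σD c k n ^ 2 :=
      mul_le_of_le_one_right (he0 n) (inv_le_one_of_one_le₀ (one_le_pow₀ hW1))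
    linarith
  obtain ⟨S, hSdef⟩ : ∃ S : ℝ, (∑' n, (1 + ‖w n‖ ^ 2 / σD c k n ^ 2) *
      ((2 * Real.pi * (1 + freqNormSq (k n))) ^ 2)⁻¹) = S := ⟨_, rfl⟩
  refine ⟨2 * (1 + D) * S ^ 2, fun ν hν => ?_⟩
  -- termwise: `X_n ≤ Y_n`
  have hXY : ∀ n, Real.sqrt ν * (Real.sqrt (lamD k n) * ‖zD c k w ν n‖) ≤
      Real.sqrt (ν ^ θ * (1 + D)) * ((1 + ‖w n‖ ^ 2 / σD c k n ^ 2) *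
        ((2 * Real.pi * (1 + freqNormSq (k n))) ^ 2)⁻¹) := by
    intro n
    have he0n := he0 n
    have hW0 : 0 < 2 * Real.pi * (1 + freqNormSq (k n)) := lt_of_lt_of_le one_pos (one_le_weightD n)
    have hX0 : 0 ≤ Real.sqrt ν * (Real.sqrt (lamD k n) * ‖zD c k w ν n‖) := by positivity
    have hY0 : 0 ≤ Real.sqrt (ν ^ θ * (1 + D)) * ((1 + ‖w n‖ ^ 2 / σD c k n ^ 2) *
        ((2 * Real.pi * (1 + freqNormSq (k n))) ^ 2)⁻¹) := by positivity
    rw [← pow_le_pow_iff_left₀ hX0 hY0 two_ne_zero]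
    have h1 := sq_gradAmpD_le (c := c) (w := w) hν (hk n) (hσ n) hθ0 hθ1
    have h2 := rpow_mul_lamD_le (k := k) hν (hk n) hθ1.le
    have h3 := rpow_norm_mul_weightD_le hw hθ0 hθ1 hm' n
    rw [hD] at h3
    calc (Real.sqrt ν * (Real.sqrt (lamD k n) * ‖zD c k w ν n‖)) ^ 2
        = ν * lamD k n * ‖zD c k w ν n‖ ^ 2 := by
          rw [mul_pow, mul_pow, Real.sq_sqrt hν.le, Real.sq_sqrt (lamD_nonneg n)]; ring
      _ ≤ (ν * lamD k n) ^ θ * ‖w n‖ ^ (1 - θ) * (1 + ‖w n‖ ^ 2 / σD c k n ^ 2) := h1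
      _ ≤ (ν ^ θ * (2 * Real.pi * (1 + freqNormSq (k n))) ^ 2) * ‖w n‖ ^ (1 - θ) *
            (1 + ‖w n‖ ^ 2 / σD c k n ^ 2) := by gcongr
      _ = ν ^ θ * (‖w n‖ ^ (1 - θ) * (2 * Real.pi * (1 + freqNormSq (k n))) ^ 6) *
            (1 + ‖w n‖ ^ 2 / σD c k n ^ 2) *
            ((2 * Real.pi * (1 + freqNormSq (k n))) ^ 2)⁻¹ ^ 2 := by
          field_simp
      _ ≤ ν ^ θ * (1 + D) * (1 + ‖w n‖ ^ 2 / σD c k n ^ 2) *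
            ((2 * Real.pi * (1 + freqNormSq (k n))) ^ 2)⁻¹ ^ 2 := by gcongr
      _ ≤ ν ^ θ * (1 + D) * (1 + ‖w n‖ ^ 2 / σD c k n ^ 2) ^ 2 *
            ((2 * Real.pi * (1 + freqNormSq (k n))) ^ 2)⁻¹ ^ 2 := by
          gcongr
          nlinarith
      _ = (Real.sqrt (ν ^ θ * (1 + D)) * ((1 + ‖w n‖ ^ 2 / σD c k n ^ 2) *
            ((2 * Real.pi * (1 + freqNormSq (k n))) ^ 2)⁻¹)) ^ 2 := by
          rw [mul_pow (Real.sqrt (ν ^ θ * (1 + D))), Real.sq_sqrt (by positivity)]; ring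
  have hXs : Summable fun n => Real.sqrt ν * (Real.sqrt (lamD k n) * ‖zD c k w ν n‖) :=
    (summable_gradAmpD hν hk hw).mul_left _
  have hsum : ∑' n, Real.sqrt ν * (Real.sqrt (lamD k n) * ‖zD c k w ν n‖) ≤
      Real.sqrt (ν ^ θ * (1 + D)) * S := by
    rw [← hSdef, ← tsum_mul_left]; exact hXs.tsum_le_tsum hXY (hS.mul_left _)
  have h0 : 0 ≤ ∑' n, Real.sqrt ν * (Real.sqrt (lamD k n) * ‖zD c k w ν n‖) :=
    tsum_nonneg fun n => by positivity
  calc ν * (eGradNormSq (UD c k w ν)).toReal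
      ≤ 2 * (∑' n, Real.sqrt ν * (Real.sqrt (lamD k n) * ‖zD c k w ν n‖)) ^ 2 :=
        dissipation_UD_le hν hk hw
    _ ≤ 2 * (Real.sqrt (ν ^ θ * (1 + D)) * S) ^ 2 := by gcongr
    _ = 2 * (1 + D) * S ^ 2 * ν ^ θ := by rw [mul_pow, Real.sq_sqrt (by positivity)]; ring

/-! ## Zeroth-law vocabulary -/

/-- `meanDissipation` of a constant-in-time field. [folklore] -/
theorem meanDissipation_of_const (ν : ℝ) (U : UnitAddTorus (Fin 3) → EuclideanSpace ℝ (Fin 3)) :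
    meanDissipation ν (fun _ : ℝ => U) = ν * (eGradNormSq U).toReal := by
  unfold meanDissipation; rw [longTimeAvgSup_of_eq_const fun t _ => rfl]

/-- **No member of the laminar drift class witnesses the zeroth law.**  Under
`A = ∑_n |w_n|/|σ_n| < ∞`: for every `θ ∈ [0,1)` there is `C` such that, for every viscosity
sequence `ν_j > 0`, the steady fields `u_j = U_{ν_j}` are global Leray–Hopf solutions under the
ONE force `f`, with `meanEnergy(u_j) ≤ |c|² + A²` and `meanDissipation(ν_j,u_j) ≤ C ν_j^θ`.
[folklore] -/
theorem driftClass_meanDissipation_le_rpow (hkinj : Function.Injective k) (hk : ∀ n, k n ≠ 0)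
    (hw : RapidDecay k w) (hσ : ∀ n, σD c k n ≠ 0)
    (hA : Summable fun n => ‖w n‖ / |σD c k n|) {θ : ℝ} (hθ0 : 0 ≤ θ) (hθ1 : θ < 1) :
    ∃ C : ℝ, ∀ ν : ℕ → ℝ, (∀ j, 0 < ν j) → ∀ j,
      Torus.IsGlobalLerayHopf (ν j) (fun _ => fD k w) (UD c k w (ν j)) (fun _ => UD c k w (ν j)) ∧
      meanEnergy (fun _ : ℝ => UD c k w (ν j)) ≤ ‖c‖ ^ 2 + (∑' n, ‖w n‖ / |σD c k n|) ^ 2 ∧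
      meanDissipation (ν j) (fun _ : ℝ => UD c k w (ν j)) ≤ C * ν j ^ θ := by
  have he : Summable fun n => ‖w n‖ ^ 2 / σD c k n ^ 2 := by
    have h := summable_sq_of_summable (fun n => by positivity) hA
    refine h.congr fun n => ?_
    rw [div_pow, sq_abs]
  obtain ⟨C, hC⟩ := dissipation_UD_le_rpow hkinj hk hw hσ he hθ0 hθ1
  refine ⟨C, fun ν hν j => ⟨(isClassicalNSSolutionOn_UD (hν j) hk hw hσ).isGlobalLerayHopf, ?_, ?_⟩⟩
  · rw [meanEnergy_eq_longTimeAvgSup, longTimeAvgSup_of_eq_const fun t _ => rfl]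
    exact integral_norm_sq_UD_le (hν j) hk hw hσ hA
  · rw [meanDissipation_of_const]; exact hC (ν j) (hν j)

/-- Hence, along `ν_j → 0`, `meanDissipation(ν_j, u_j) → 0`. [folklore] -/
theorem driftClass_meanDissipation_tendsto_zero (hkinj : Function.Injective k) (hk : ∀ n, k n ≠ 0)
    (hw : RapidDecay k w) (hσ : ∀ n, σD c k n ≠ 0) (hA : Summable fun n => ‖w n‖ / |σD c k n|)
    {ν : ℕ → ℝ} (hν : ∀ j, 0 < ν j) (hν0 : Tendsto ν atTop (𝓝 0)) :
    Tendsto (fun j => meanDissipation (ν j) (fun _ : ℝ => UD c k w (ν j))) atTop (𝓝 0) := by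
  obtain ⟨C, hC⟩ := driftClass_meanDissipation_le_rpow hkinj hk hw hσ hA
    (by norm_num : (0 : ℝ) ≤ 1 / 2) (by norm_num : (1 : ℝ) / 2 < 1)
  have hlim : Tendsto (fun j => C * ν j ^ (1 / 2 : ℝ)) atTop (𝓝 0) := by
    have h := (hν0.rpow_const (Or.inr (by norm_num : (0 : ℝ) ≤ 1 / 2))).const_mul C
    rwa [Real.zero_rpow (by norm_num), mul_zero] at h
  refine squeeze_zero (fun j => ?_) (fun j => (hC ν hν j).2.2) hlim
  rw [meanDissipation_of_const]; exact mul_nonneg (hν j).le ENNReal.toReal_nonneg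

/-- **No dissipation floor**: the last clause of `Literature.Turb.ZerothLaw` fails for every
Leray–Hopf family drawn from the laminar drift class (one smooth force, bounded mean energy,
`ν_j → 0`). [folklore] -/
theorem driftClass_no_dissipationFloor (hkinj : Function.Injective k) (hk : ∀ n, k n ≠ 0)
    (hw : RapidDecay k w) (hσ : ∀ n, σD c k n ≠ 0) (hA : Summable fun n => ‖w n‖ / |σD c k n|)
    {ν : ℕ → ℝ} (hν : ∀ j, 0 < ν j) (hν0 : Tendsto ν atTop (𝓝 0)) :
    ¬ ∃ ε : ℝ, 0 < ε ∧ ∀ j, ε ≤ meanDissipation (ν j) (fun _ : ℝ => UD c k w (ν j)) := by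
  rintro ⟨ε, hε, hfloor⟩
  obtain ⟨j, hj⟩ := ((tendsto_order.1
    (driftClass_meanDissipation_tendsto_zero hkinj hk hw hσ hA hν hν0)).2 ε hε).exists
  exact absurd (hfloor j) (not_le.2 hj)

end Summit.AnomalousDissipation.AnomalousDissipation.Theorems

end
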